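import Summits.QuantumFields.YangMills.Theorems.BalabanUVNodesN08HaarCompatibilityGuardFlatFibre
import Summits.QuantumFields.YangMills.Theorems.BalabanUVNodesN08HaarCompatibilityGuardReparamFibre

/-!
# BalabanUVNodes ∕ N08 — PART 8's SUFFICIENT CONDITION `Ψ_*(dU) = dU` IS FALSE AT THE SLOT: the central reparametrisation `Ψ` of the typed (0.4)
# averaging is NOT `dU`-invariant (`SU(N)`, `N ≥ 2`, every member, every in-range level) — road (iv) to the typed E6′ letter is CLOSED

WIDTH SEAT `pub-ymgap-dag-n08-w3` g3, plan `W-SEAT-START-LIST.md` v8 §n08 item 3 PART 12B (successor piece of part 8 p597554 `…GuardReparam`, parts 11∕11B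
p601453 `…GuardPowerMap` ∕ `…GuardFlatFibre` and the generic half 12A `…GuardReparamFibre`), 2026-08-28.  Track A, DAG node N08 = [Balaban1985UV3] Thm 1
p. 257 (compact) + Thm 2 p. 272; key item K1⁷ `StabilityBAtRecordR13SepCoPH` (stmt-QuantumFields-20542), `--supports … --as helper`.  COUNT-NEUTRAL.

THE POINT.  Part 8 (`map_avOfPrint_eq_of_map_reparam_eq`) offered `Ψ_*(dU) = dU` as a sufficient condition for the typed E6′ letter; g2's HANDOFF named it
road (iv) «a statement about the one-variable fibre laws; hypothesis likely FALSE».  Parts 11∕11B computed the fibre map of `Ψ` at the FLAT background (the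
`L^{1−d}`-power map on the guard ball, identity off it) and showed its law is not Haar — a strict defect at ONE, `dU`-null, background; part 12A supplied the
structural lemmas (resampling, the fibre map `φ(U, g) = pre(U)⁻¹ · Ū(c₀)(U[β(c₀) ↦ g]) · post(U)⁻¹` of `Ψ`, its blindness to central coordinates, the
reset `Π`).  This file spreads the strict defect to a `dU`-POSITIVE set of backgrounds and integrates it:
(1) CONTINUITY (§1): `(U, g) ↦ φ(U, g)` is continuous at every `(1, g)` with `dist1 g < δ_N` (there `U[β(c₀) ↦ g]` lies in the OPEN guard of `c₀`, on which
    the typed averaging is continuous — `SubstrateBlockAvgContinuity`), and `dist1 φ(1, g) ≤ ρ₀ := e^{2δ_N∕3} − 1` (part 11); by the TUBE LEMMA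
    (`IsCompact.eventually_forall_of_forall_eventually`, the closed `r₀`-ball being compact) there is an OPEN `𝒱 ∋ 1` with `dist1 φ(V, g) < ρ` for ALL
    `V ∈ 𝒱`, `dist1 g ≤ r₀` (`ρ₀ < ρ < r₀ < δ_N`).
(2) THE WITNESS (§2): `B := {U | Π U ∈ 𝒱} ∩ {U | dist1 U(β(c₀)) < ρ}`.  By resampling and blindness, `dU(B) = dU{Π U ∈ 𝒱} · Haar{dist1 < ρ}` while
    `dU(Ψ⁻¹ B) = ∫_{Π U ∈ 𝒱} Haar{g | dist1 φ(U, g) < ρ} dU ≥ dU{Π U ∈ 𝒱} · Haar{dist1 ≤ r₀}`; `{Π U ∈ 𝒱}` is open and contains `1`, so `dU`-positive,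
    and `Haar{dist1 ≤ r₀} > Haar{dist1 < ρ}` by the annulus lemma of part 11B (`N ≥ 2`).  Hence ★★★ `dU(B) < Ψ_*(dU)(B)`: `Ψ_*(dU) ≠ dU`
    (`map_reparam_ne`), and the hypothesis `hΨ` of part 8's `map_avOfPrint_eq_of_map_reparam_eq` is uninhabited at every `N ≥ 2` (§3 `not_part8_hypothesis`).

WHAT THIS DOES AND DOES NOT SAY.  Road (iv) is CLOSED: the typed E6′ letter `(avOfPrint)_*(dU) = dV` can NOT be obtained from `dU`-invariance of `Ψ`.
E6′ itself is NOT decided here: by part 6 it is the restricted identity `(dU↾guard)∘Ū⁻¹ = (dU↾guard)∘axial⁻¹`, and `Ū_*(dU) = axial_*(Ψ_*(dU))` may still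
equal `dV` by cancellation in the mixture over backgrounds (single-bond marginals ARE Haar, p585871; forests ARE product Haar, p589866).  Count-neutral; N08 NOT
discharged; counts unmoved (typed 28∕28 · discharged 5∕27); one finite 𝕋⁴ programme at fixed ε — R4 closes the CONDITIONAL rung `BalabanLadder.UV` only;
the Yang–Mills mass gap (Clay) is NOT proved by any of this; nothing continuum ∕ ℝ³ ∕ ℝ⁴ ∕ OS ∕ mass gap.  [folklore] measure theory over landed modules;
nothing of Bałaban's asserted; 0 `sorry`, 0 `def`, 0 `instance`, standard axioms.
-/

noncomputable section

open MeasureTheory Function Filter Topology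

namespace Summit.QuantumFields.YangMills.BalabanUVNodes.N08HaarCompatibilityGuardReparamDefect

open Literature.MathematicalPhysics.QuantumFieldTheory.Balaban1983to89
open Literature.MathematicalPhysics.QuantumFieldTheory.Balaban1983to89.T4Continuum
open Literature.MathematicalPhysics.QuantumFieldTheory.Balaban1983to89.BlockAveraging (Idx Small corr avgFun)
open Literature.MathematicalPhysics.QuantumFieldTheory.Balaban1983to89.BlockAveragingHaarAC (centralBond pre post)
open Summit.QuantumFields.YangMills.BalabanUVNodes.N08HaarCompatibilityGuardReparam (measurable_reparam)
open Summit.QuantumFields.YangMills.BalabanUVNodes.N08HaarCompatibilityGuardReparamFibre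
  (measurePreserving_update reparam_update_apply_centralBond fibre_reset reset_update reset_reparam reset_one measurable_reset measurable_fibre)

/-! ## §1. Continuity of the fibre map near the flat background, uniformly on the closed `r₀`-ball (tube lemma) -/

section Continuity

open scoped Matrix.Norms.L2Operator
open ExpMeanLog (expMeanLogSU deltaSU deltaSU_pos)
open Literature.MathematicalPhysics.QuantumFieldTheory.Balaban1983to89.Node00 (SU)
open Summit.QuantumFields.BalabanUV.T4Continuum.SubstrateBlockAvgContinuity
  (continuous_holAt continuous_loopHol continuousOn_rawAvg_eval smallContinuous_expMeanLogSU continuous_dist1_SU rawAvg avg_eq_rawAvg_of_small)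
open Summit.QuantumFields.YangMills.BalabanUVNodes.N09OneDefectAveraging (pre_one post_one)
open Summit.QuantumFields.YangMills.BalabanUVNodes.N08HaarCompatibilityGuardPowerMap
  (small_update_one_iff delta_eq dist1_avgFun_update_one_le rho_lt_deltaSU)

variable (N : ℕ) [NeZero N] {P : Params} {j : ℕ}

/-- The guard of `c₀` is OPEN among `SU(N)`-configurations (loop variables and `dist1` continuous; part 6's `isOpen_small` at a general `Params`). [folklore] -/
theorem isOpen_small' (c₀ : PBond P (j + 1)) :
    IsOpen {U : GaugeField P j (SU N) | Small (expMeanLogSU : LoopAverage (SU N)) U c₀} := by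
  simp only [BlockAveraging.Small, Set.setOf_forall]
  exact isOpen_iInter_of_finite fun i => isOpen_lt ((continuous_dist1_SU (n := Fin N)).comp (continuous_loopHol c₀ i)) continuous_const

/-- The typed averaging of `c₀` is continuous on the guard of `c₀` (`SU(N)`, printed exp-mean-log: `SubstrateBlockAvgContinuity.continuousOn_rawAvg_eval`).
[folklore] -/
theorem continuousOn_avgFun_eval (c₀ : PBond P (j + 1)) :
    ContinuousOn (fun U : GaugeField P j (SU N) => avgFun (expMeanLogSU : LoopAverage (SU N)) U c₀)
      {U : GaugeField P j (SU N) | Small (expMeanLogSU : LoopAverage (SU N)) U c₀} :=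
  (continuousOn_rawAvg_eval (expMeanLogSU : LoopAverage (SU N)) smallContinuous_expMeanLogSU c₀).congr
    fun _ hU => avg_eq_rawAvg_of_small (expMeanLogSU : LoopAverage (SU N)) hU

/-- **THE FIBRE MAP IS CONTINUOUS AT `(1, g)` FOR `g` INSIDE THE GUARD** (`dist1 g < δ_N`, `d ≥ 2`, standing range): there `1[β(c₀) ↦ g]` lies in the open
guard of `c₀`, on which the typed averaging is continuous; `pre`, `post`, `update` are continuous. [folklore] -/
theorem continuousAt_fibre (hj : j + 1 ≤ P.m + P.K) (hd : 2 ≤ P.d) (c₀ : PBond P (j + 1)) {g : SU N} (hg : dist1 g < deltaSU (Fin N)) :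
    ContinuousAt (fun p : GaugeField P j (SU N) × SU N =>
        (pre p.1 c₀)⁻¹ * avgFun (expMeanLogSU : LoopAverage (SU N)) (update p.1 (centralBond c₀) p.2) c₀ * (post p.1 c₀)⁻¹) (1, g) := by
  have hupd : Continuous fun p : GaugeField P j (SU N) × SU N => update p.1 (centralBond c₀) p.2 :=
    continuous_fst.update (centralBond c₀) continuous_snd
  have hmem : update (1 : GaugeField P j (SU N)) (centralBond c₀) g ∈
      {U : GaugeField P j (SU N) | Small (expMeanLogSU : LoopAverage (SU N)) U c₀} :=
    (small_update_one_iff (expMeanLogSU : LoopAverage (SU N)) hj hd c₀ g).2 hg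
  have h1 : ContinuousAt (fun U : GaugeField P j (SU N) => avgFun (expMeanLogSU : LoopAverage (SU N)) U c₀)
      (update (1 : GaugeField P j (SU N)) (centralBond c₀) g) :=
    (continuousOn_avgFun_eval N c₀).continuousAt ((isOpen_small' N c₀).mem_nhds hmem)
  have h2 : ContinuousAt (fun p : GaugeField P j (SU N) × SU N => update p.1 (centralBond c₀) p.2) ((1 : GaugeField P j (SU N)), g) :=
    hupd.continuousAt
  have hav : ContinuousAt (fun p : GaugeField P j (SU N) × SU N =>
      avgFun (expMeanLogSU : LoopAverage (SU N)) (update p.1 (centralBond c₀) p.2) c₀) (1, g) := h1.comp_of_eq h2 rfl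
  have hpre : ContinuousAt (fun p : GaugeField P j (SU N) × SU N => (pre p.1 c₀)⁻¹) ((1 : GaugeField P j (SU N)), g) :=
    (((continuous_holAt _).comp continuous_fst).inv).continuousAt
  have hpost : ContinuousAt (fun p : GaugeField P j (SU N) × SU N => (post p.1 c₀)⁻¹) ((1 : GaugeField P j (SU N)), g) :=
    (((continuous_holAt _).comp continuous_fst).inv).continuousAt
  exact (hpre.mul hav).mul hpost

/-- At the flat background the fibre map IS the flat fibre map of part 11 (`pre 1 = post 1 = 1`). [folklore] -/
theorem fibre_one (c₀ : PBond P (j + 1)) (g : SU N) :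
    (pre (1 : GaugeField P j (SU N)) c₀)⁻¹ * avgFun (expMeanLogSU : LoopAverage (SU N)) (update (1 : GaugeField P j (SU N)) (centralBond c₀) g) c₀ *
        (post (1 : GaugeField P j (SU N)) c₀)⁻¹ =
      avgFun (expMeanLogSU : LoopAverage (SU N)) (update (1 : GaugeField P j (SU N)) (centralBond c₀) g) c₀ := by
  rw [pre_one, post_one, inv_one, one_mul, mul_one]

/-- **THE TUBE LEMMA STEP**: with `ρ₀ := e^{2δ_N∕3} − 1 < ρ` and `r₀ < δ_N`, for all backgrounds `V` NEAR the flat one and ALL `g` in the (compact) closed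
`r₀`-ball, `dist1 φ(V, g) < ρ` — continuity at each `(1, g)` (value there of `dist1 ≤ ρ₀`, part 11) spread over the compact ball by
`IsCompact.eventually_forall_of_forall_eventually`. [folklore] -/
theorem eventually_forall_dist1_fibre_lt (hj : j + 1 ≤ P.m + P.K) (hd : 2 ≤ P.d) (c₀ : PBond P (j + 1)) {ρ r₀ : ℝ}
    (hρ : Real.exp (2 * deltaSU (Fin N) / 3) - 1 < ρ) (hr₀ : r₀ < deltaSU (Fin N)) :
    ∀ᶠ V in 𝓝 (1 : GaugeField P j (SU N)), ∀ g ∈ {g : SU N | dist1 g ≤ r₀},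
      dist1 ((pre V c₀)⁻¹ * avgFun (expMeanLogSU : LoopAverage (SU N)) (update V (centralBond c₀) g) c₀ * (post V c₀)⁻¹) < ρ := by
  have hK : IsCompact {g : SU N | dist1 g ≤ r₀} := (isClosed_le (continuous_dist1_SU (n := Fin N)) continuous_const).isCompact
  refine hK.eventually_forall_of_forall_eventually fun g hg => ?_
  have hgδ : dist1 g < deltaSU (Fin N) := lt_of_le_of_lt hg hr₀
  have hval : dist1 ((pre (1 : GaugeField P j (SU N)) c₀)⁻¹ *
      avgFun (expMeanLogSU : LoopAverage (SU N)) (update (1 : GaugeField P j (SU N)) (centralBond c₀) g) c₀ * (post (1 : GaugeField P j (SU N)) c₀)⁻¹) < ρ := by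
    rw [fibre_one]
    exact (dist1_avgFun_update_one_le N hj hd c₀ g hgδ).trans_lt hρ
  exact (continuousAt_fibre N hj hd c₀ hgδ).eventually ((isOpen_lt (continuous_dist1_SU (n := Fin N)) continuous_const).mem_nhds hval)

end Continuity

/-! ## §2. The witness: a measurable `B` with `dU(B) < Ψ_*(dU)(B)` — `Ψ_*(dU) ≠ dU` -/

section Witness

open scoped Matrix.Norms.L2Operator
open ExpMeanLog (expMeanLogSU deltaSU deltaSU_pos measurable_expMeanLogSU_E)
open Literature.MathematicalPhysics.QuantumFieldTheory.Balaban1983to89.Node00 (SU)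
open Literature.MathematicalPhysics.QuantumFieldTheory.Balaban1983to89.B12ContinuousTransportInvariance (isOpenPosMeasure_fieldMeasure_SU)
open Summit.QuantumFields.BalabanUV.T4Continuum.SubstrateBlockAvgContinuity (continuous_dist1_SU)
open Summit.QuantumFields.YangMills.BalabanUVNodes.N08HaarCompatibilityGuardPowerMap (rho_lt_deltaSU)
open Summit.QuantumFields.YangMills.BalabanUVNodes.N08HaarCompatibilityGuardFlatFibre (haar_annulus_pos)

variable (N : ℕ) [NeZero N] {P : Params} {j : ℕ}

omit [NeZero N] in
/-- The reset `Π` is continuous (`SU(N)`). [folklore] -/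
theorem continuous_reset : Continuous (Y := GaugeField P j (SU N)) fun (U : GaugeField P j (SU N)) b =>
    Function.extend centralBond (fun c => (U (centralBond c))⁻¹) (fun _ => (1 : SU N)) b * U b := by
  classical
  refine continuous_pi fun b => Continuous.mul ?_ (continuous_apply b)
  simp only [Function.extend_def]
  split_ifs
  · exact (continuous_apply _).inv
  · exact continuous_const

/-- **★★★ THE WITNESS.**  `SU(N)`, `N ≥ 2`, `d ≥ 2`, standing range, any coarse bond `c₀`: there is a measurable set `B` of fine configurations with
`dU(B) < dU(Ψ⁻¹ B)` — `B = {Π U ∈ 𝒱} ∩ {dist1 U(β(c₀)) < ρ}` with `𝒱` the tube-lemma neighbourhood of the flat background; `dU(B) = dU{Π U ∈ 𝒱}·Haar{dist1 < ρ}`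
(resampling) `< dU{Π U ∈ 𝒱}·Haar{dist1 ≤ r₀}` (annulus, `N ≥ 2`; `{Π U ∈ 𝒱}` open `∋ 1` hence `dU`-positive) `≤ dU(Ψ⁻¹ B)` (resampling + every fibre over
`{Π U ∈ 𝒱}` maps the `r₀`-ball into `{dist1 < ρ}`). [cite: Balaban1987RG1, (0.4) p.253 (the typed averaging; its central reparametrisation is NOT
`dU`-invariant — E6′ ∕ fibre statements NOT IN PRINT; bookkeeping)] -/
theorem exists_measure_lt_measure_preimage_reparam (hN : 2 ≤ N) (hj : j + 1 ≤ P.m + P.K) (hd : 2 ≤ P.d) (c₀ : PBond P (j + 1)) :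
    ∃ B : Set (GaugeField P j (SU N)), MeasurableSet B ∧
      fieldMeasure P j (SU N) B <
        (fieldMeasure P j (SU N)).map (β := GaugeField P j (SU N)) (fun U b => Function.extend centralBond
          (fun c => (pre U c)⁻¹ * corr (expMeanLogSU : LoopAverage (SU N)) U c * pre U c) (fun _ => (1 : SU N)) b * U b) B := by
  haveI : BorelSpace (GaugeField P j (SU N)) := inferInstanceAs (BorelSpace (PBond P j → SU N))
  haveI := HaarData.isProb (G := SU N)
  -- names
  set ℰ : LoopAverage (SU N) := expMeanLogSU with hℰ
  set μ : Measure (SU N) := HaarData.haar with hμ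
  set dU : Measure (GaugeField P j (SU N)) := fieldMeasure P j (SU N) with hdU
  have hdUpi : dU = Measure.pi fun _ : PBond P j => μ := rfl
  set Ψ : GaugeField P j (SU N) → GaugeField P j (SU N) := fun U b =>
    Function.extend centralBond (fun c => (pre U c)⁻¹ * corr ℰ U c * pre U c) (fun _ => (1 : SU N)) b * U b with hΨ
  set Rst : GaugeField P j (SU N) → GaugeField P j (SU N) := fun U b =>
    Function.extend centralBond (fun c => (U (centralBond c))⁻¹) (fun _ => (1 : SU N)) b * U b with hRst
  set φ : GaugeField P j (SU N) × SU N → SU N := fun p => (pre p.1 c₀)⁻¹ * avgFun ℰ (update p.1 (centralBond c₀) p.2) c₀ * (post p.1 c₀)⁻¹ with hφ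
  -- the radii `ρ₀ < ρ < r₀ < δ`
  set δ : ℝ := deltaSU (Fin N) with hδ
  set ρ₀ : ℝ := Real.exp (2 * δ / 3) - 1 with hρ₀
  have hδ0 : 0 < δ := deltaSU_pos
  have hρ₀0 : 0 ≤ ρ₀ := by rw [hρ₀, sub_nonneg]; exact Real.one_le_exp (by positivity)
  have hρ₀δ : ρ₀ < δ := rho_lt_deltaSU N
  have hδ2 : δ ≤ 2 := (min_le_left _ _).trans (by norm_num)
  set ρ : ℝ := (2 * ρ₀ + δ) / 3 with hρ
  set r₀ : ℝ := (ρ₀ + 2 * δ) / 3 with hr₀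
  have hρ₀ρ : ρ₀ < ρ := by rw [hρ]; linarith
  have hρr₀ : ρ < r₀ := by rw [hρ, hr₀]; linarith
  have hr₀δ : r₀ < δ := by rw [hr₀]; linarith
  have hρ0 : 0 ≤ ρ := hρ₀0.trans hρ₀ρ.le
  -- the tube-lemma neighbourhood `𝒱` of the flat background
  obtain ⟨𝒱, h𝒱sub, h𝒱open, h1𝒱⟩ := mem_nhds_iff.1 (eventually_forall_dist1_fibre_lt N hj hd c₀ hρ₀ρ hr₀δ)
  -- the sets
  set Nset : Set (GaugeField P j (SU N)) := Rst ⁻¹' 𝒱 with hNset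
  set K : Set (SU N) := {x : SU N | dist1 x < ρ} with hK
  set K₀ : Set (SU N) := {g : SU N | dist1 g ≤ r₀} with hK₀
  have hmeas1 : Measurable (dist1 : SU N → ℝ) := RegularGaugeGroup.measurable_dist1
  have hKm : MeasurableSet K := measurableSet_lt hmeas1 measurable_const
  have hNm : MeasurableSet Nset := h𝒱open.measurableSet.preimage measurable_reset
  set B₁ : Set (GaugeField P j (SU N)) := Nset ∩ {U : GaugeField P j (SU N) | U (centralBond c₀) ∈ K} with hB₁
  have hB₁m : MeasurableSet B₁ := hNm.inter (hKm.preimage (measurable_pi_apply (centralBond c₀)))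
  refine ⟨B₁, hB₁m, ?_⟩
  -- resampling
  set R : GaugeField P j (SU N) × SU N → GaugeField P j (SU N) := fun p => update p.1 (centralBond c₀) p.2 with hRdef
  have hR : MeasurePreserving R (dU.prod μ) dU := by
    rw [hdUpi]
    exact measurePreserving_update (ι := PBond P j) μ (centralBond c₀)
  -- (i) `dU(B) = dU(N) · μ(K)`
  have hB : dU B₁ = dU Nset * μ K := by
    have hpre : R ⁻¹' B₁ = Nset ×ˢ K := by
      ext ⟨U, g⟩
      show (Rst (update U (centralBond c₀) g) ∈ 𝒱 ∧ update U (centralBond c₀) g (centralBond c₀) ∈ K) ↔ (Rst U ∈ 𝒱 ∧ g ∈ K)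
      rw [update_self, show Rst (update U (centralBond c₀) g) = Rst U from reset_update hj U c₀ g]
    rw [← hR.measure_preimage hB₁m.nullMeasurableSet, hpre, Measure.prod_prod]
  -- (ii) `dU(Ψ⁻¹ B) ≥ dU(N) · μ(K₀)`
  set E : Set (GaugeField P j (SU N) × SU N) := {p | p.1 ∈ Nset ∧ φ p ∈ K} with hEdef
  have hE : R ⁻¹' (Ψ ⁻¹' B₁) = E := by
    ext ⟨U, g⟩
    show (Rst (Ψ (update U (centralBond c₀) g)) ∈ 𝒱 ∧ Ψ (update U (centralBond c₀) g) (centralBond c₀) ∈ K) ↔ (Rst U ∈ 𝒱 ∧ φ (U, g) ∈ K)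
    rw [show Rst (Ψ (update U (centralBond c₀) g)) = Rst U from (reset_reparam ℰ hj _).trans (reset_update hj U c₀ g),
      show Ψ (update U (centralBond c₀) g) (centralBond c₀) = φ (U, g) from reparam_update_apply_centralBond ℰ hj U c₀ g]
  have hEm : MeasurableSet E :=
    (hNm.preimage measurable_fst).inter (hKm.preimage (measurable_fibre ℰ measurable_expMeanLogSU_E c₀))
  have hfib : ∀ U ∈ Nset, K₀ ⊆ {g | φ (U, g) ∈ K} := by
    intro U hU g hg
    have h := h𝒱sub hU g hg
    show dist1 ((pre U c₀)⁻¹ * avgFun ℰ (update U (centralBond c₀) g) c₀ * (post U c₀)⁻¹) < ρ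
    rw [← fibre_reset ℰ hj U c₀ g]
    exact h
  have hΨB : dU Nset * μ K₀ ≤ dU (Ψ ⁻¹' B₁) := by
    have hΨm : Measurable Ψ := measurable_reparam ℰ measurable_expMeanLogSU_E
    rw [← hR.measure_preimage (hΨm hB₁m).nullMeasurableSet, hE, Measure.prod_apply hEm, mul_comm, ← lintegral_indicator_const hNm (μ K₀)]
    refine lintegral_mono fun U => ?_
    by_cases hU : U ∈ Nset
    · rw [Set.indicator_of_mem hU]
      refine (measure_mono (hfib U hU)).trans (measure_mono fun g hg => ?_)
      exact ⟨hU, hg⟩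
    · rw [Set.indicator_of_notMem hU]
      exact zero_le
  -- (iii) `μ K < μ K₀` (annulus) and (iv) `0 < dU N`
  have hKK₀ : μ K < μ K₀ := by
    have hann := haar_annulus_pos N hN hρ0 hρr₀ (hr₀δ.le.trans hδ2)
    have hdisj : Disjoint K {g : SU N | ρ < dist1 g ∧ dist1 g < r₀} := Set.disjoint_left.2 fun g hg hg' => (lt_asymm hg) hg'.1
    have hannm : MeasurableSet {g : SU N | ρ < dist1 g ∧ dist1 g < r₀} :=
      (measurableSet_lt measurable_const hmeas1).inter (measurableSet_lt hmeas1 measurable_const)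
    calc μ K < μ K + μ {g : SU N | ρ < dist1 g ∧ dist1 g < r₀} := ENNReal.lt_add_right (measure_ne_top _ _) hann.ne'
      _ = μ (K ∪ {g : SU N | ρ < dist1 g ∧ dist1 g < r₀}) := (measure_union hdisj hannm).symm
      _ ≤ μ K₀ := measure_mono (by
          rintro g (hg | hg)
          · exact le_of_lt (lt_trans hg hρr₀)
          · exact hg.2.le)
  have hN0 : 0 < dU Nset := by
    have hopen : IsOpen Nset := h𝒱open.preimage (continuous_reset N)
    have h1N : (1 : GaugeField P j (SU N)) ∈ Nset := by
      show Rst 1 ∈ 𝒱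
      rw [show Rst 1 = 1 from reset_one]
      exact h1𝒱
    exact pos_iff_ne_zero.2 ((isOpenPosMeasure_fieldMeasure_SU N P j).open_pos _ hopen ⟨1, h1N⟩)
  -- (v) assemble
  have hΨm : Measurable Ψ := measurable_reparam ℰ measurable_expMeanLogSU_E
  rw [Measure.map_apply hΨm hB₁m]
  calc dU B₁ = dU Nset * μ K := hB
    _ < dU Nset * μ K₀ := ENNReal.mul_lt_mul_right hN0.ne' (measure_ne_top _ _) hKK₀
    _ ≤ dU (Ψ ⁻¹' B₁) := hΨB

/-- **★★★ THE CENTRAL REPARAMETRISATION IS NOT `dU`-INVARIANT: `Ψ_*(dU) ≠ dU`** (`SU(N)`, `N ≥ 2`, `d ≥ 2`, standing range) — the sufficient condition of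
part 8's `map_avgFun_eq_of_map_reparam_eq` FAILS for the printed exp-mean-log. [cite: Balaban1987RG1, (0.4) p.253 (bookkeeping; E6′ itself NOT IN PRINT and
NOT decided by this)] -/
theorem map_reparam_ne (hN : 2 ≤ N) (hj : j + 1 ≤ P.m + P.K) (hd : 2 ≤ P.d) :
    (fieldMeasure P j (SU N)).map (β := GaugeField P j (SU N)) (fun U b => Function.extend centralBond
        (fun c => (pre U c)⁻¹ * corr (expMeanLogSU : LoopAverage (SU N)) U c * pre U c) (fun _ => (1 : SU N)) b * U b) ≠
      fieldMeasure P j (SU N) := by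
  intro h
  obtain ⟨B, -, hlt⟩ := exists_measure_lt_measure_preimage_reparam N hN hj hd (⟨default, ⟨0, by have := P.hd; omega⟩⟩ : PBond P (j + 1))
  rw [h] at hlt
  exact lt_irrefl _ hlt

end Witness

/-! ## §3. At the [B10] slot: road (iv) is closed -/

section Slot

open scoped Matrix.Norms.L2Operator
open Literature.MathematicalPhysics.QuantumFieldTheory.Balaban1985CMP102.Setting (Scales)
open Literature.MathematicalPhysics.QuantumFieldTheory.Balaban1983to89.B10RunsOfRecord (avOfPrint)
open ExpMeanLog (expMeanLogSU)
open Literature.MathematicalPhysics.QuantumFieldTheory.Balaban1983to89.Node00 (SU)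

variable (N : ℕ) [NeZero N] {L : ℕ}

/-- **★★★ AT THE SLOT: `Ψ_*(dU) ≠ dU`** for print's averaging of record `avOfPrint N S j` — every `N ≥ 2`, every member `S`, every in-range level `j`, any
witness bond. [cite: Balaban1985UV3, (2) p.256; Balaban1987RG1, (0.4) p.253 (bookkeeping; E6′ NOT IN PRINT, not decided here)] -/
theorem map_reparam_ne_slot (hN : 2 ≤ N) (S : Scales L) {j : ℕ} (hj : j + 1 ≤ S.P.m + S.P.K) :
    (fieldMeasure S.P j (SU N)).map (β := GaugeField S.P j (SU N)) (fun U b => Function.extend centralBond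
        (fun c => (pre U c)⁻¹ * corr (expMeanLogSU : LoopAverage (SU N)) U c * pre U c) (fun _ => (1 : SU N)) b * U b) ≠
      fieldMeasure S.P j (SU N) :=
  map_reparam_ne N hN hj (show 2 ≤ S.P.d from by show 2 ≤ 3; norm_num)

/-- **ROAD (iv) IS CLOSED**: the hypothesis `hΨ` of part 8's `map_avOfPrint_eq_of_map_reparam_eq` ∕ `TFamily_one_ae_eq_one_of_map_reparam_eq` is uninhabited
at every `N ≥ 2` — the typed E6′ letter cannot be obtained from `dU`-invariance of the central reparametrisation (it stays the restricted identity on the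
guard of part 6, UNDECIDED). [cite: Balaban1985UV3, (2) p.256; Balaban1987RG1, (0.4) p.253 (bookkeeping)] -/
theorem not_part8_hypothesis (hN : 2 ≤ N) (S : Scales L) {j : ℕ} (hj : j + 1 ≤ S.P.m + S.P.K) :
    ¬ ((fieldMeasure S.P j (SU N)).map (β := GaugeField S.P j (SU N)) (fun U b => Function.extend centralBond
        (fun c => (pre U c)⁻¹ * corr (expMeanLogSU : LoopAverage (SU N)) U c * pre U c) (fun _ => (1 : SU N)) b * U b) =
      fieldMeasure S.P j (SU N)) :=
  map_reparam_ne_slot N hN S hj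

end Slot

end Summit.QuantumFields.YangMills.BalabanUVNodes.N08HaarCompatibilityGuardReparamDefect

end
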